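import Mathlib
import HarnessLib
import Summits.Ventures.LatticeQCDFlow.Scoring.ChainMartingaleFourthMoment
import Summits.Ventures.LatticeQCDFlow.Scoring.MinorisedGreenKubo
import Summits.Ventures.LatticeQCDFlow.Scoring.SplitChainFreshPairMoments

/-!
# Block sums of a Doeblin chain from any start: `E_{μ₀}[(Σ_{t<n} f̄(X_{s+t}))⁴] ≤ 512 (4C/e)⁴ n²`,
# `|E_{μ₀}[M_{s,n}²] − n σ²_f| ≤ 2 C_h²/e`, and the conditional variance of the Poisson solution has
# `π`-mean equal to the Green–Kubo variance `σ²_f`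

HONEST FRAMING: exact (Metropolis-corrected) sampling algorithms for lattice gauge theory;
figures of merit are autocorrelation/cost numbers at stated couplings and volumes; no
continuum-physics claim.

Venture `LatticeQCDFlow` (cell pub-lqcd), topic `Scoring`; FANOUT row 8 (`s0-cpn-nemc`, GEN-19).
NEW WORK of the cell, not a published result; no definition is introduced.  Setting: `κ` a Markov
kernel with invariant probability `π` and a minorisation `κ(x, ·) ≥ ε ν` by ANY probability law `ν`
(`0 < ε < 1`, `e = ε.toReal`) — the certificate shape of every exact sampler of the venture; `|f| ≤ C`
measurable, `f̄ = f − π f`, `σ²_f = ∫ f̄² dπ + 2 Σ_{k≥1} ∫ f̄ (kop κ)^[k] f̄ dπ` the Green–Kubo (integrated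
autocorrelation) variance written as in `Scoring/MarkovChainCLT.lean`.  The tree's Poisson solution
`h = Σ_t (kop κ)^[t] f̄` (`Scoring/MinorisedGreenKubo.poisson_exists_minorised`, `|h| ≤ 4C/e`) turns
the conditional statements of `Scoring/ChainMartingaleFourthMoment.lean` into unconditional moment
bounds for block sums of `f̄` from ANY initial law and ANY block position; and the conditional
variance observable `q = kop κ (h²) − (kop κ h)²` of `Scoring/ChainMartingaleIncrements.lean` has
`π(q) = ∫ h² dπ − ∫ (kop κ h)² dπ = 2 ∫ f̄ h dπ − ∫ f̄² dπ = σ²_f` by invariance and the tree's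
Green–Kubo `HasSum` (`greenKubo_hasSum_minorised`), while `|E_{μ₀}[q(X_u)] − π(q)| ≤ 2 C_h² (1−e)^u`
by the sup-norm decay of centred observables (`abs_iterate_kop_centred_le_minorised`), so the block
martingale's second moment is `n σ²_f + O(1)` uniformly.  These are the inputs of
`Scoring/BatchMeansConsistency.lean`.  Printed counterparts NAMED ONLY, nothing cited as a fact: the
Poisson-equation form of the asymptotic variance `σ²_f = π(h²) − π((Ph)²)` (Meyn–Tweedie 1993
Thm 17.4.4 / eq. (17.47)).

## Content (`κ(x, ·) ≥ ε ν`, `0 < ε < 1`, `π` invariant; `P_{μ₀}` the chain's path law from `μ₀`)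

* **`abs_chain_blockMartingale_sq_sub_le_minorised`** — for `|h| ≤ C_h` measurable and
  `q = kop κ (h²) − (kop κ h)²`: `|E_{μ₀}[M_{s,n}²] − n π(q)| ≤ 2 C_h²/e` for all `μ₀`, `s`, `n`;
* **`poisson_condVar_integral_eq_greenKubo`** — for any bounded measurable `h` with
  `h − kop κ h = f̄`: `π(q) = ∫ f̄² dπ + 2 Σ' k, ∫ f̄ (kop κ)^[k+1] f̄ dπ`;
* **`chain_blockSum_fourth_le_minorised`** — `E_{μ₀}[(Σ_{t<n} (f(X_{s+t}) − π f))⁴] ≤ 512 (4C/e)⁴ n²`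
  (`n ≥ 1`), every `μ₀`, every `s`;
* **`chain_blockSum_sq_le_minorised`** — `E_{μ₀}[(Σ_{t<n} (f(X_{s+t}) − π f))²] ≤ 10 (4C/e)² n`;
* **`abs_chain_blockSum_sq_sub_le_minorised`** — `|E_{μ₀}[(Σ_{t<n} (f(X_{s+t}) − π f))²] − n σ²_f|
  ≤ (4C/e)² (2/e + 4 + 4√n)`: the second moment of a block sum is `n σ²_f + O(√n)` UNIFORMLY in the
  initial law and the block position (the any-start, any-position form of
  `Scoring/ChainMeanSquareErrorSharp.chain_mse_tendsto_greenKubo`, with a rate).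

NOT CLAIMED: sharp constants; any `ε` of a concrete sampler; unbounded observables.
-/

noncomputable section

namespace Summit.Ventures.LatticeQCDFlow.Scoring

open MeasureTheory ProbabilityTheory Filter Finset Preorder Literature.Probability.MarkovChains
open scoped ENNReal Topology

variable {Ω : Type*} [MeasurableSpace Ω]

/-! ### Under a minorisation: the conditional variance has `π`-mean `σ²_f` -/

section Minorised

variable {κ : Kernel Ω Ω} [IsMarkovKernel κ] {ν : Measure Ω} [IsProbabilityMeasure ν] {ε : ℝ≥0∞}
  {π : Measure Ω} [IsProbabilityMeasure π]

/-- **`|E_{μ₀}[M_{s,n}²] − n π(q)| ≤ 2 C_h²/e`**: the block martingale's second moment is `n π(q)` up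
to a bounded error, uniformly in `s` and the initial law (`κ(x, ·) ≥ ε ν`, `0 < ε < 1`, `π`
invariant, `|h| ≤ C_h`). -/
theorem abs_chain_blockMartingale_sq_sub_le_minorised (hπ : Kernel.Invariant κ π)
    (hmin : ∀ x {B : Set Ω}, MeasurableSet B → ε * ν B ≤ κ x B) (hε0 : 0 < ε) (hε : ε < 1)
    {h : Ω → ℝ} (hh : Measurable h) {Ch : ℝ} (hCh : ∀ x, |h x| ≤ Ch)
    (μ₀ : Measure Ω) [IsProbabilityMeasure μ₀] (s n : ℕ) :
    |∫ x, (∑ t ∈ Finset.range n, (h (x (s + t + 1)) - kop κ h (x (s + t)))) ^ 2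
        ∂(Kernel.trajMeasure (X := fun _ : ℕ => Ω) μ₀
          (fun n : ℕ => κ.comap (fun h : (i : ↥(Finset.Iic n)) → Ω => h ⟨n, Finset.mem_Iic.2 le_rfl⟩)
            (measurable_pi_apply _)))
      - n * ∫ y, (kop κ (fun z => h z ^ 2) y - (kop κ h y) ^ 2) ∂π|
      ≤ 2 * Ch ^ 2 / ε.toReal := by
  obtain ⟨-, hl0, he1⟩ := one_sub_toReal_eq_of_lt_one (ε := ε) hε
  have he0 : 0 < ε.toReal := ENNReal.toReal_pos hε0.ne' (ne_top_of_lt hε)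
  have hl1 : 1 - ε.toReal < 1 := by linarith
  obtain ⟨hqm, hqb⟩ := kopCondVar_bounded_measurable κ hh hCh
  set q : Ω → ℝ := fun y => kop κ (fun z => h z ^ 2) y - (kop κ h y) ^ 2 with hq
  set m : ℝ := ∫ y, q y ∂π with hm
  -- the centred observable `q − m`
  have hmb : |m| ≤ Ch ^ 2 := by
    calc |m| = ‖∫ y, q y ∂π‖ := (Real.norm_eq_abs _).symm
      _ ≤ Ch ^ 2 * π.real Set.univ := norm_integral_le_of_norm_le_const (Eventually.of_forall
          fun y => by rw [Real.norm_eq_abs]; exact hqb y)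
      _ = Ch ^ 2 := by rw [probReal_univ, mul_one]
  have hcm : Measurable fun y => q y - m := hqm.sub measurable_const
  -- both `q` and `m` lie in `[0, C_h²]`, so `|q − m| ≤ C_h²`
  have hm0 : 0 ≤ m := integral_nonneg fun y => kopCondVar_nonneg κ hh hCh y
  have hmle : m ≤ Ch ^ 2 := (le_abs_self _).trans hmb
  have hcb : ∀ y, |q y - m| ≤ Ch ^ 2 := fun y =>
    abs_le.2 ⟨by linarith [kopCondVar_nonneg κ hh hCh y], by linarith [kopCondVar_le κ hCh y]⟩
  have hc0 : ∫ y, (q y - m) ∂π = 0 := by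
    rw [integral_sub (integrable_of_bounded π hqm hqb) (integrable_const m), integral_const,
      probReal_univ, one_smul, hm, sub_self]
  -- `E[q(X_u)] − m = ∫ K^u (q − m) dμ₀`, bounded by `2 C_h² ρ^u`
  have hstep : ∀ u : ℕ, |∫ x, q (x u) ∂(Kernel.trajMeasure (X := fun _ : ℕ => Ω) μ₀
      (fun n : ℕ => κ.comap (fun h : (i : ↥(Finset.Iic n)) → Ω => h ⟨n, Finset.mem_Iic.2 le_rfl⟩)
        (measurable_pi_apply _))) - m| ≤ 2 * Ch ^ 2 * (1 - ε.toReal) ^ u := by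
    intro u
    obtain ⟨hKm, hKb⟩ := iterate_kop_bounded_measurable κ hcm hcb u
    have h1 : ∫ x, q (x u) ∂(Kernel.trajMeasure (X := fun _ : ℕ => Ω) μ₀
        (fun n : ℕ => κ.comap (fun h : (i : ↥(Finset.Iic n)) → Ω => h ⟨n, Finset.mem_Iic.2 le_rfl⟩)
          (measurable_pi_apply _))) - m
        = ∫ y, (kop κ)^[u] (fun z => q z - m) y ∂μ₀ := by
      rw [chain_expect κ μ₀ hqm hqb u, iterate_kop_sub_const (κ := κ) hqm hqb m u,
        integral_sub (integrable_of_bounded μ₀ (iterate_kop_bounded_measurable κ hqm hqb u).1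
          (iterate_kop_bounded_measurable κ hqm hqb u).2) (integrable_const _), integral_const,
        probReal_univ, one_smul]
    rw [h1]
    calc |∫ y, (kop κ)^[u] (fun z => q z - m) y ∂μ₀| = ‖∫ y, (kop κ)^[u] (fun z => q z - m) y ∂μ₀‖ :=
          (Real.norm_eq_abs _).symm
      _ ≤ 2 * Ch ^ 2 * (1 - ε.toReal) ^ u * μ₀.real Set.univ :=
          norm_integral_le_of_norm_le_const (Eventually.of_forall fun y => by
            rw [Real.norm_eq_abs]
            exact abs_iterate_kop_centred_le_minorised (κ := κ) (ν := ν) hπ hmin hε hcm hcb hc0 u y)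
      _ = 2 * Ch ^ 2 * (1 - ε.toReal) ^ u := by rw [probReal_univ, mul_one]
  rw [chain_blockMartingale_sq_eq κ μ₀ hh hCh s n]
  have hsum : (n : ℝ) * m = ∑ t ∈ Finset.range n, m := by
    rw [Finset.sum_const, Finset.card_range, nsmul_eq_mul]
  rw [hsum, ← Finset.sum_sub_distrib]
  calc |∑ t ∈ Finset.range n, (∫ x, q (x (s + t)) ∂(Kernel.trajMeasure (X := fun _ : ℕ => Ω) μ₀
        (fun n : ℕ => κ.comap (fun h : (i : ↥(Finset.Iic n)) → Ω => h ⟨n, Finset.mem_Iic.2 le_rfl⟩)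
          (measurable_pi_apply _))) - m)|
      ≤ ∑ t ∈ Finset.range n, |∫ x, q (x (s + t)) ∂(Kernel.trajMeasure (X := fun _ : ℕ => Ω) μ₀
        (fun n : ℕ => κ.comap (fun h : (i : ↥(Finset.Iic n)) → Ω => h ⟨n, Finset.mem_Iic.2 le_rfl⟩)
          (measurable_pi_apply _))) - m| := Finset.abs_sum_le_sum_abs _ _
    _ ≤ ∑ t ∈ Finset.range n, 2 * Ch ^ 2 * (1 - ε.toReal) ^ (s + t) :=
        Finset.sum_le_sum fun t _ => hstep (s + t)
    _ ≤ ∑ t ∈ Finset.range n, 2 * Ch ^ 2 * (1 - ε.toReal) ^ t := by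
        refine Finset.sum_le_sum fun t _ => mul_le_mul_of_nonneg_left ?_ (by positivity)
        rw [pow_add]
        exact mul_le_of_le_one_left (pow_nonneg hl0 t) (pow_le_one₀ hl0 hl1.le)
    _ ≤ 2 * Ch ^ 2 / ε.toReal := by
        have hgeo : HasSum (fun t : ℕ => 2 * Ch ^ 2 * (1 - ε.toReal) ^ t) (2 * Ch ^ 2 / ε.toReal) := by
          have hg := (hasSum_geometric_of_lt_one hl0 hl1).mul_left (2 * Ch ^ 2)
          have he : 2 * Ch ^ 2 * (1 - (1 - ε.toReal))⁻¹ = 2 * Ch ^ 2 / ε.toReal := by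
            rw [sub_sub_cancel, div_eq_mul_inv]
          rwa [he] at hg
        exact sum_le_hasSum _ (fun t _ => by positivity) hgeo

/-- **THE `π`-MEAN OF THE CONDITIONAL VARIANCE IS THE GREEN–KUBO VARIANCE.**  For `π` invariant,
`κ(x, ·) ≥ ε ν` (`0 < ε < 1`), `|f| ≤ C` measurable, `f̄ = f − π f`, and `h` ANY bounded measurable
solution of `h − kop κ h = f̄`:
`∫ (kop κ (h²) − (kop κ h)²) dπ = ∫ f̄² dπ + 2 Σ_{k≥0} ∫ f̄ · (kop κ)^[k+1] f̄ dπ`. -/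
theorem poisson_condVar_integral_eq_greenKubo (hπ : Kernel.Invariant κ π)
    (hmin : ∀ x {B : Set Ω}, MeasurableSet B → ε * ν B ≤ κ x B) (hε0 : 0 < ε) (hε : ε < 1)
    {f : Ω → ℝ} (hf : Measurable f) {C : ℝ} (hC : ∀ x, |f x| ≤ C)
    {h : Ω → ℝ} (hh : Measurable h) {Ch : ℝ} (hCh : ∀ x, |h x| ≤ Ch)
    (hpois : ∀ y, h y - kop κ h y = f y - ∫ z, f z ∂π) :
    ∫ y, (kop κ (fun z => h z ^ 2) y - (kop κ h y) ^ 2) ∂π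
      = (∫ y, (f y - ∫ z, f z ∂π) ^ 2 ∂π)
        + 2 * ∑' k, ∫ y, (f y - ∫ z, f z ∂π) * (kop κ)^[k + 1] (fun y => f y - ∫ z, f z ∂π) y ∂π := by
  obtain ⟨hfb, hCfb, hfb0⟩ := centred_observable_bounds π hf hC
  set fb : Ω → ℝ := fun y => f y - ∫ z, f z ∂π with hfbdef
  -- Green–Kubo: `Σ_t γ_t = ∫ f̄ h dπ`, so the tail sum is `∫ f̄ h dπ − ∫ f̄² dπ`
  have hGK := greenKubo_hasSum_minorised (κ := κ) (ν := ν) hπ hmin hε0 hε hfb hCfb hfb0 hh hCh hpois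
  have h1 := (hasSum_nat_add_iff' (f := fun t => autocov κ π fb t) 1).2 hGK
  rw [Finset.sum_range_one, autocov_zero] at h1
  unfold autocov at h1
  rw [h1.tsum_eq]
  -- `∫ K(h²) dπ = ∫ h² dπ` (invariance) and `(Kh)² = (h − f̄)²`
  have hh2 : Measurable fun y => h y ^ 2 := hh.pow_const 2
  have hCh2 : ∀ y, |h y ^ 2| ≤ Ch ^ 2 := fun y => by
    rw [abs_pow]; exact pow_le_pow_left₀ (abs_nonneg _) (hCh y) 2
  have hK2 : ∫ y, kop κ (fun z => h z ^ 2) y ∂π = ∫ y, h y ^ 2 ∂π := integral_kop κ hπ hh2 hCh2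
  have hKh : ∀ y, kop κ h y = h y - fb y := fun y => by
    have := hpois y
    show kop κ h y = h y - (f y - ∫ z, f z ∂π)
    linarith
  have hiK2 : Integrable (fun y => kop κ (fun z => h z ^ 2) y) π :=
    integrable_of_bounded π (measurable_kop κ hh2) (abs_kop_le κ hCh2)
  have hiKh2 : Integrable (fun y => (kop κ h y) ^ 2) π :=
    integrable_of_bounded π ((measurable_kop κ hh).pow_const 2) (C := Ch ^ 2) fun y => by
      rw [abs_pow]; exact pow_le_pow_left₀ (abs_nonneg _) (abs_kop_le κ hCh y) 2
  have hih2 : Integrable (fun y => h y ^ 2) π := integrable_of_bounded π hh2 hCh2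
  have hifh : Integrable (fun y => fb y * h y) π :=
    integrable_of_bounded π (hfb.mul hh) (C := 2 * C * Ch) fun y => by
      rw [abs_mul]
      exact mul_le_mul (hCfb y) (hCh y) (abs_nonneg _) (by linarith [abs_nonneg (fb y), hCfb y])
  have hif2 : Integrable (fun y => fb y ^ 2) π :=
    integrable_of_bounded π (hfb.pow_const 2) (C := (2 * C) ^ 2) fun y => by
      rw [abs_pow]; exact pow_le_pow_left₀ (abs_nonneg _) (hCfb y) 2
  have hexp : ∀ y, (kop κ h y) ^ 2 = h y ^ 2 - 2 * (fb y * h y) + fb y ^ 2 := fun y => by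
    rw [hKh y]; ring
  have hA : ∫ y, (kop κ (fun z => h z ^ 2) y - (kop κ h y) ^ 2) ∂π
      = 2 * ∫ y, fb y * h y ∂π - ∫ y, fb y ^ 2 ∂π := by
    have hi4 : Integrable (fun y => h y ^ 2 - 2 * (fb y * h y)) π := hih2.sub (hifh.const_mul 2)
    rw [integral_sub hiK2 hiKh2, hK2, integral_congr_ae (ae_of_all _ hexp), integral_add hi4 hif2,
      integral_sub hih2 (hifh.const_mul 2), integral_const_mul]
    ring
  rw [hA]
  show 2 * ∫ y, fb y * h y ∂π - ∫ y, fb y ^ 2 ∂π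
    = (∫ y, fb y ^ 2 ∂π) + 2 * (∫ x, fb x * h x ∂π - ∫ x, fb x ^ 2 ∂π)
  ring

/-- **THE FOURTH-MOMENT BOUND FOR BLOCK SUMS OF A DOEBLIN CHAIN, FROM ANY START.**  `π` an invariant
probability law of the Markov kernel `κ`, `κ(x, ·) ≥ ε ν` (`ν` any probability law, `0 < ε < 1`),
`|f| ≤ C` measurable.  For EVERY initial law `μ₀`, every `s` and every `n ≥ 1`:
`E_{μ₀}[(Σ_{t<n} (f(X_{s+t}) − π f))⁴] ≤ 512 (4C/e)⁴ n²` (`e = ε.toReal`). -/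
theorem chain_blockSum_fourth_le_minorised (hπ : Kernel.Invariant κ π)
    (hmin : ∀ x {B : Set Ω}, MeasurableSet B → ε * ν B ≤ κ x B) (hε0 : 0 < ε) (hε : ε < 1)
    {f : Ω → ℝ} (hf : Measurable f) {C : ℝ} (hC : ∀ x, |f x| ≤ C)
    (μ₀ : Measure Ω) [IsProbabilityMeasure μ₀] (s : ℕ) {n : ℕ} (hn : n ≠ 0) :
    ∫ x, (∑ t ∈ Finset.range n, (f (x (s + t)) - ∫ z, f z ∂π)) ^ 4
        ∂(Kernel.trajMeasure (X := fun _ : ℕ => Ω) μ₀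
          (fun n : ℕ => κ.comap (fun h : (i : ↥(Finset.Iic n)) → Ω => h ⟨n, Finset.mem_Iic.2 le_rfl⟩)
            (measurable_pi_apply _)))
      ≤ 512 * (4 * C / ε.toReal) ^ 4 * (n : ℝ) ^ 2 := by
  obtain ⟨hfb, hCfb, hfb0⟩ := centred_observable_bounds π hf hC
  obtain ⟨h, hh, hCh, hpois⟩ := poisson_exists_minorised (κ := κ) (ν := ν) hπ hmin hε0 hε hfb hCfb hfb0
  have hCh' : ∀ x, |h x| ≤ 4 * C / ε.toReal := fun x => (hCh x).trans (le_of_eq (by ring))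
  exact chain_blockSum_fourth_le_of_poisson κ μ₀ hh hCh' hfb hpois s hn

/-- **Second moment of block sums, any start** (same hypotheses):
`E_{μ₀}[(Σ_{t<n} (f(X_{s+t}) − π f))²] ≤ 10 (4C/e)² n`. -/
theorem chain_blockSum_sq_le_minorised (hπ : Kernel.Invariant κ π)
    (hmin : ∀ x {B : Set Ω}, MeasurableSet B → ε * ν B ≤ κ x B) (hε0 : 0 < ε) (hε : ε < 1)
    {f : Ω → ℝ} (hf : Measurable f) {C : ℝ} (hC : ∀ x, |f x| ≤ C)
    (μ₀ : Measure Ω) [IsProbabilityMeasure μ₀] (s : ℕ) {n : ℕ} (hn : n ≠ 0) :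
    ∫ x, (∑ t ∈ Finset.range n, (f (x (s + t)) - ∫ z, f z ∂π)) ^ 2
        ∂(Kernel.trajMeasure (X := fun _ : ℕ => Ω) μ₀
          (fun n : ℕ => κ.comap (fun h : (i : ↥(Finset.Iic n)) → Ω => h ⟨n, Finset.mem_Iic.2 le_rfl⟩)
            (measurable_pi_apply _)))
      ≤ 10 * (4 * C / ε.toReal) ^ 2 * n := by
  obtain ⟨hfb, hCfb, hfb0⟩ := centred_observable_bounds π hf hC
  obtain ⟨h, hh, hCh, hpois⟩ := poisson_exists_minorised (κ := κ) (ν := ν) hπ hmin hε0 hε hfb hCfb hfb0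
  have hCh' : ∀ x, |h x| ≤ 4 * C / ε.toReal := fun x => (hCh x).trans (le_of_eq (by ring))
  exact chain_blockSum_sq_le_of_poisson κ μ₀ hh hCh' hfb hpois s hn

/-- **THE SECOND MOMENT OF A BLOCK SUM IS `n σ²_f + O(√n)`, UNIFORMLY IN THE START AND THE BLOCK
POSITION.**  `π` invariant, `κ(x, ·) ≥ ε ν` (`0 < ε < 1`), `|f| ≤ C` measurable; for EVERY `μ₀`, `s`, `n`:
`|E_{μ₀}[(Σ_{t<n} (f(X_{s+t}) − π f))²] − n σ²_f| ≤ (4C/e)² (2/e + 4 + 4 √n)`. -/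
theorem abs_chain_blockSum_sq_sub_le_minorised (hπ : Kernel.Invariant κ π)
    (hmin : ∀ x {B : Set Ω}, MeasurableSet B → ε * ν B ≤ κ x B) (hε0 : 0 < ε) (hε : ε < 1)
    {f : Ω → ℝ} (hf : Measurable f) {C : ℝ} (hC : ∀ x, |f x| ≤ C)
    (μ₀ : Measure Ω) [IsProbabilityMeasure μ₀] (s n : ℕ) :
    |∫ x, (∑ t ∈ Finset.range n, (f (x (s + t)) - ∫ z, f z ∂π)) ^ 2
        ∂(Kernel.trajMeasure (X := fun _ : ℕ => Ω) μ₀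
          (fun n : ℕ => κ.comap (fun h : (i : ↥(Finset.Iic n)) → Ω => h ⟨n, Finset.mem_Iic.2 le_rfl⟩)
            (measurable_pi_apply _)))
      - n * ((∫ y, (f y - ∫ z, f z ∂π) ^ 2 ∂π)
        + 2 * ∑' k, ∫ y, (f y - ∫ z, f z ∂π) * (kop κ)^[k + 1] (fun y => f y - ∫ z, f z ∂π) y ∂π)|
      ≤ (4 * C / ε.toReal) ^ 2 * (2 / ε.toReal + 4 + 4 * Real.sqrt n) := by
  set P := Kernel.trajMeasure (X := fun _ : ℕ => Ω) μ₀
      (fun n : ℕ => κ.comap (fun h : (i : ↥(Finset.Iic n)) → Ω => h ⟨n, Finset.mem_Iic.2 le_rfl⟩)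
        (measurable_pi_apply _)) with hP
  obtain ⟨hfb, hCfb, hfb0⟩ := centred_observable_bounds π hf hC
  obtain ⟨h, hh, hCh, hpois⟩ := poisson_exists_minorised (κ := κ) (ν := ν) hπ hmin hε0 hε hfb hCfb hfb0
  set Ch : ℝ := 4 * C / ε.toReal with hChdef
  have hCh' : ∀ x, |h x| ≤ Ch := fun x => (hCh x).trans (le_of_eq (by rw [hChdef]; ring))
  have hCh0 : 0 ≤ Ch := (abs_nonneg _).trans (hCh' (Classical.choice (nonempty_of_isProbabilityMeasure π)))
  have he0 : 0 < ε.toReal := ENNReal.toReal_pos hε0.ne' (ne_top_of_lt hε)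
  set c := ∫ z, f z ∂π with hc
  -- `σ²_f = π(q)`
  rw [← poisson_condVar_integral_eq_greenKubo (κ := κ) (ν := ν) hπ hmin hε0 hε hf hC hh hCh' hpois]
  -- the martingale part
  set M : (ℕ → Ω) → ℝ := fun x =>
    ∑ t ∈ Finset.range n, (h (x (s + t + 1)) - kop κ h (x (s + t))) with hMdef
  have hMm : Measurable M := blockMartingale_measurable κ hh s n
  have hMb : ∀ x, |M x| ≤ n * (2 * Ch) := abs_blockMartingale_le κ hCh' s n
  have hM2 : ∫ x, M x ^ 2 ∂P ≤ n * Ch ^ 2 := chain_blockMartingale_sq_le κ μ₀ hh hCh' s n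
  have hMσ := abs_chain_blockMartingale_sq_sub_le_minorised (κ := κ) (ν := ν) hπ hmin hε0 hε hh hCh' μ₀ s n
  rw [← hP] at hMσ
  -- `E|M| ≤ √n C_h`
  have hiM : Integrable M P := integrable_of_bounded P hMm hMb
  have hEabsM : ∫ x, |M x| ∂P ≤ Real.sqrt n * Ch := by
    have hJ := sq_integral_le_integral_sq P (hMm.abs) (C := n * (2 * Ch)) (fun x => by
      rw [abs_abs]; exact hMb x)
    have hJ' : (∫ x, |M x| ∂P) ^ 2 ≤ n * Ch ^ 2 := by
      refine hJ.trans ?_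
      rw [show (fun x => |M x| ^ 2) = fun x => M x ^ 2 from funext fun x => sq_abs _]
      exact hM2
    calc ∫ x, |M x| ∂P ≤ Real.sqrt (n * Ch ^ 2) := Real.le_sqrt_of_sq_le hJ'
      _ = Real.sqrt n * Ch := by rw [Real.sqrt_mul (Nat.cast_nonneg n), Real.sqrt_sq hCh0]
  -- `S = M + Δ`, `|Δ| ≤ 2 C_h`
  have hΔb : ∀ x : ℕ → Ω, |h (x s) - h (x (s + n))| ≤ 2 * Ch := fun x =>
    (abs_sub _ _).trans (by linarith [hCh' (x s), hCh' (x (s + n))])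
  have hΔm : Measurable fun x : ℕ → Ω => h (x s) - h (x (s + n)) :=
    (hh.comp (measurable_pi_apply _)).sub (hh.comp (measurable_pi_apply _))
  have hS : ∀ x : ℕ → Ω, (∑ t ∈ Finset.range n, (f (x (s + t)) - c)) ^ 2
      = M x ^ 2 + (2 * M x * (h (x s) - h (x (s + n))) + (h (x s) - h (x (s + n))) ^ 2) := fun x => by
    rw [blockSum_eq_blockMartingale_add (kop κ) hpois s n x]
    ring
  have hiM2 : Integrable (fun x => M x ^ 2) P :=
    integrable_of_bounded P (hMm.pow_const 2) (C := (n * (2 * Ch)) ^ 2) fun x => by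
      rw [abs_pow]; exact pow_le_pow_left₀ (abs_nonneg _) (hMb x) 2
  have hrest_m : Measurable fun x : ℕ → Ω =>
      2 * M x * (h (x s) - h (x (s + n))) + (h (x s) - h (x (s + n))) ^ 2 :=
    ((hMm.const_mul 2).mul hΔm).add (hΔm.pow_const 2)
  have hrest_b : ∀ x : ℕ → Ω, |2 * M x * (h (x s) - h (x (s + n))) + (h (x s) - h (x (s + n))) ^ 2|
      ≤ 2 * (2 * Ch) * |M x| + (2 * Ch) ^ 2 := fun x => by
    refine (abs_add_le _ _).trans (add_le_add ?_ ?_)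
    · calc |2 * M x * (h (x s) - h (x (s + n)))| = 2 * |M x| * |h (x s) - h (x (s + n))| := by
            rw [abs_mul, abs_mul, abs_two]
        _ ≤ 2 * |M x| * (2 * Ch) :=
            mul_le_mul_of_nonneg_left (hΔb x) (mul_nonneg zero_le_two (abs_nonneg _))
        _ = 2 * (2 * Ch) * |M x| := by ring
    · rw [abs_pow]; exact pow_le_pow_left₀ (abs_nonneg _) (hΔb x) 2
  have h4Ch : 0 ≤ 2 * (2 * Ch) := by positivity
  have hirest : Integrable (fun x : ℕ → Ω =>
      2 * M x * (h (x s) - h (x (s + n))) + (h (x s) - h (x (s + n))) ^ 2) P :=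
    integrable_of_bounded P hrest_m (C := 2 * (2 * Ch) * (n * (2 * Ch)) + (2 * Ch) ^ 2) fun x =>
      (hrest_b x).trans (add_le_add_left (mul_le_mul_of_nonneg_left (hMb x) h4Ch) _)
  have hiAbsM : Integrable (fun x => 2 * (2 * Ch) * |M x|) P := hiM.abs.const_mul _
  have hiAbsM' : Integrable (fun x => 2 * (2 * Ch) * |M x| + (2 * Ch) ^ 2) P :=
    hiAbsM.add (integrable_const _)
  have hErest : |∫ x, (2 * M x * (h (x s) - h (x (s + n))) + (h (x s) - h (x (s + n))) ^ 2) ∂P|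
      ≤ 2 * (2 * Ch) * (Real.sqrt n * Ch) + (2 * Ch) ^ 2 := by
    calc |∫ x, (2 * M x * (h (x s) - h (x (s + n))) + (h (x s) - h (x (s + n))) ^ 2) ∂P|
        ≤ ∫ x, |2 * M x * (h (x s) - h (x (s + n))) + (h (x s) - h (x (s + n))) ^ 2| ∂P :=
          abs_integral_le_integral_abs
      _ ≤ ∫ x, (2 * (2 * Ch) * |M x| + (2 * Ch) ^ 2) ∂P :=
          integral_mono_of_nonneg (ae_of_all _ fun x => abs_nonneg _) hiAbsM' (ae_of_all _ hrest_b)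
      _ = 2 * (2 * Ch) * ∫ x, |M x| ∂P + (2 * Ch) ^ 2 := by
          rw [integral_add hiAbsM (integrable_const _), integral_const_mul,
            integral_const, smul_eq_mul, probReal_univ, one_mul]
      _ ≤ 2 * (2 * Ch) * (Real.sqrt n * Ch) + (2 * Ch) ^ 2 :=
          add_le_add_left (mul_le_mul_of_nonneg_left hEabsM h4Ch) _
  have hsplit : ∫ x, (∑ t ∈ Finset.range n, (f (x (s + t)) - c)) ^ 2 ∂P
      = ∫ x, M x ^ 2 ∂P
        + ∫ x, (2 * M x * (h (x s) - h (x (s + n))) + (h (x s) - h (x (s + n))) ^ 2) ∂P := by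
    rw [integral_congr_ae (ae_of_all _ hS), integral_add hiM2 hirest]
  rw [hsplit]
  have hsq0 : 0 ≤ Real.sqrt n := Real.sqrt_nonneg _
  calc |∫ x, M x ^ 2 ∂P
        + ∫ x, (2 * M x * (h (x s) - h (x (s + n))) + (h (x s) - h (x (s + n))) ^ 2) ∂P
        - n * ∫ y, (kop κ (fun z => h z ^ 2) y - (kop κ h y) ^ 2) ∂π|
      ≤ |∫ x, M x ^ 2 ∂P - n * ∫ y, (kop κ (fun z => h z ^ 2) y - (kop κ h y) ^ 2) ∂π|
        + |∫ x, (2 * M x * (h (x s) - h (x (s + n))) + (h (x s) - h (x (s + n))) ^ 2) ∂P| := by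
        rw [show ∫ x, M x ^ 2 ∂P
          + ∫ x, (2 * M x * (h (x s) - h (x (s + n))) + (h (x s) - h (x (s + n))) ^ 2) ∂P
          - n * ∫ y, (kop κ (fun z => h z ^ 2) y - (kop κ h y) ^ 2) ∂π
          = (∫ x, M x ^ 2 ∂P - n * ∫ y, (kop κ (fun z => h z ^ 2) y - (kop κ h y) ^ 2) ∂π)
            + ∫ x, (2 * M x * (h (x s) - h (x (s + n))) + (h (x s) - h (x (s + n))) ^ 2) ∂P by ring]
        exact abs_add_le _ _
    _ ≤ 2 * Ch ^ 2 / ε.toReal + (2 * (2 * Ch) * (Real.sqrt n * Ch) + (2 * Ch) ^ 2) :=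
        add_le_add hMσ hErest
    _ = Ch ^ 2 * (2 / ε.toReal + 4 + 4 * Real.sqrt n) := by
        field_simp
        ring

end Minorised

end Summit.Ventures.LatticeQCDFlow.Scoring

end
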